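import Literature.Geometry.Hyperkaehler.GenericInducedComplexStructure
import Literature.Geometry.Hyperkaehler.TwistorLineHermitianFormSignature
import Mathlib.LinearAlgebra.QuadraticForm.Signature
import Mathlib.LinearAlgebra.Complex.FiniteDimensional
import HarnessLib

/-!
# Twistor spheres and the Hodge locus `Compl_Ω` of a `2`-form — Buskin–Izadi Lemma 3.2 (a twistor sphere meets `Compl_Ω`
# in a finite set or lies in it), Cor. 5.5, and Thm. 5.4's criterion for a twistor sphere through `I` inside `Compl_Ω`
# (sphere level; Sylvester's vocabulary) (consolidated file)

Topic `Literature/Geometry/Hyperkaehler`; namespaces `Literature.Geometry.Hyperkaehler.TwistorSphereLocus` (Part A) and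
`Literature.Geometry.Hyperkaehler.TwistorLineSylvester` (Part B). THEOREMS ONLY (no definition, no named fact, no `sorry`);
every import is Mathlib, HarnessLib or a BUILT file of this directory (`GenericInducedComplexStructure`,
`TwistorLineHermitianFormSignature`). Nothing in this file is a statement about the Hodge conjecture, and nothing here says
that any object is hyperholomorphic, rotable or carries a twistor line: the statements are finite-dimensional linear algebra
on a complex normed space `E` (`I = i•`) with a second complex structure `J` anticommuting with `I`.

**Provenance ∕ consolidation (D-0064: one Lean file per coherent cluster).** Written by the literature seat `lit-w-verbitsky`
of the cell `pub-hsemireg` (HodgeConjecture venture): the two Parts below are the seat's standalone drafts of 2026-08-25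
(generation 16), consolidated into one module by generation 17 on 2026-08-26 — both are the sphere-level companions of the
tree's `TwistorLineHermitianFormSignature.lean` (the signature criterion of [BI20] Thm. 5.4 ∕ Cor. 5.5 on the carrier `E`).
Each Part reproduces its draft VERBATIM — the draft's module docstring (with its verbatim quotations of the source, read
against the arXiv v2 text layer by a second seat) followed by its code, byte-identical; only the `import` lines were
hoisted and de-duplicated, each draft's file-level `open` lines were placed in a `section` around its `namespace` block, and
the anonymous `noncomputable section` is opened once. Where a Part's docstring says "this leaf", read "this Part";
`TwistorSphereHodgeLocusFinite.lean` = Part A, `TwistorLineSignatureSylvester.lean` = Part B; "keyed", "row", "lineage"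
are that cell's filing vocabulary and carry no mathematical content.

## Source

[BuskinIzadi2020TwistorLinesTori] N. Buskin, E. Izadi, *Twistor lines in the period domain of complex tori*, Geom. Dedicata
213 (2021) 21–47 = arXiv:1806.07831v2 (28 Jun 2020) ("v2 p.N Lm" in the Parts = PDF page N, text-layer line m of arXiv v2):
§1.1 twistor spheres `S(I, J)` (v2 p.5 L36–39), §3.2 `Compl_Ω` and Lemma 3.2 (v2 p.14 L29–32, L42–43; proof p.15 L3–8),
§5 the hermitian form `h` and its signature (v2 p.23 L20–30), Thm. 5.4 (v2 p.24 L54–74), Cor. 5.5 (v2 p.24 L76–77). arXiv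
v1 LACKS §5 — cite v2 for Part B and for Part A §4–§5.

## Contents

* Part A — Lemma 3.2 on the carrier `E` via the tree's `𝔰𝔲(2)` argument, sharpened: the unit parameters `x` with
  `λ_x = x₀I + x₁J + x₂K ∈ Compl_Ω` form a set contained in some `{x₀, −x₀}`, or all of the sphere, the latter iff `Ω` is
  `I`- and `J`-invariant (`finite_or_forall_twistorOp_invariant`, `exists_subset_pair_or_forall`,
  `forall_twistorOp_invariant_iff`); Cor. 5.5 at sphere level (`twistorOp_invariant_iff_of_pos`,
  `not_forall_twistorOp_invariant_of_pos`); Thm. 5.4's twistor-line clause at `I`, sphere level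
  (`exists_forall_twistorOp_invariant_iff_finrank_pos_eq_finrank_neg`).
* Part B — Thm. 5.4's criterion read through Mathlib's Sylvester indices of the REAL quadratic form
  `q(u) = h(u, u) = Ω(u, Iu)`: `sigPos q = 2·#{d_k > 0}`, `sigNeg q = 2·#{d_k < 0}`, `dim_ℝ rad q = 2·#{d_k = 0}` in an
  `h`-orthogonal complex frame; a `J` with `J² = −1`, `JI = −IJ`, `Ω(J·, J·) = Ω` exists iff `sigPos q = sigNeg q`
  (`exists_anticommuting_invariant_iff_sigPos_eq_sigNeg`, `exists_isLinearHyperkaehler_invariant_of_sigPos_eq_sigNeg`).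

## What is NOT in this file

`Compl`, `Compl_Ω`, `S(I, J)`, `Sign` as named objects; the analytic proof of Lemma 3.2 as printed (complex-analytic subsets
of `Compl`) — Part A takes the shorter algebraic road and says so; Thm. 5.4's statements about connected components, `π₀`,
homogeneity and twistor PATH connectivity; §5's eq. (9), Prop. 5.1, Lemma 5.2, Lemma 5.3 (the real-carrier companion
`HodgeLocusSignature.lean` of the same seat).

## References

* [BuskinIzadi2020TwistorLinesTori] N. Buskin, E. Izadi, *Twistor lines in the period domain of complex tori*, Geom. Dedicata
  213 (2021) 21–47 = arXiv:1806.07831v2: §1.1 (p.5 L36–39), §3.2 Lemma 3.2 (p.14 L42–43; proof p.15 L3–8), §5 (p.23 L20–30),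
  Thm. 5.4 (p.24 L54–74), Cor. 5.5 (p.24 L76–77).
-/

noncomputable section

open Module

/-!
## Part A — standalone draft `TwistorSphereHodgeLocusFinite.v3` (sha256∕16 8b4b08d079688efe), reproduced verbatim below
(its module docstring first: references to "this file" ∕ "this leaf" mean this Part; items it lists as
"NOT here" may be supplied by other Parts — see the file header; then its code, byte-identical).

# [BI20] Lemma 3.2: a twistor sphere meets the locus `Compl_Ω` of a `2`-form in a finite set, or lies in it

[BI20] = Buskin–Izadi, *Twistor lines in the period domain of complex tori*, arXiv:1806.07831v2 ("v2 p.N Lm" = PDF page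
N, text-layer line m of the v2 PDF). v2 p.5 L36–39: "Assume that `J : V_ℝ → V_ℝ` is a complex structure anticommuting
with `I`. Then `I` and `J` determine a twistor sphere `S(I, J) := {aI + bJ + cK | a² + b² + c² = 1}`, where `K = IJ`."
p.14 L29–32: "For an alternating form `Ω` on `V_ℝ` we denote by `Compl_Ω` the locus of periods in `Compl` at which `Ω`
represents a class of Hodge (1,1)-type, that is `Compl_Ω = {I ∈ Compl | Ω(I·, I·) = Ω(·, ·)}`." p.14 L42–43:
"**Lemma 3.2.** For any alternating form `Ω` and any twistor sphere `S`, the intersection `S ∩ Compl_Ω` is either finite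
or all of `S`." Printed proof (p.15 L3–8): "Follows from the fact that `Compl_Ω` and `S` are complex analytic subsets of
`Compl`. The twistor sphere `S` is analytic by Corollary 1.8. The subset `Compl_Ω` is a complex analytic subvariety in
`Compl` as it is the locus where `Ω` belongs to the fiber of a holomorphic subbundle of the Hodge bundle on `Compl`
arising from the Hodge filtration."

This leaf proves Lemma 3.2 on the tree's carrier — a complex normed space `E` (`I = i•`), a second complex-structure
operator `J` anticommuting with `I`, `K = IJ` (`opK J`), the twistor sphere parametrised by the unit sphere of `ℝ³`,
`x ↦ λ_x = x₀ I + x₁ J + x₂ K` (as in `GenericInducedComplexStructure.lean`), and `Ω` any continuous alternating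
`2`-form with values in a real normed space `W` — by a SHORTER ROAD than the printed analytic one, which also sharpens
it: every quaternionic pair `(I, J)` carries a compatible inner product (the tree's
`exists_isLinearHyperkaehler_of_anticommuting`, `TwistorLineHermitianFormSignature.lean`), and for a linear hyperkähler
structure the tree's degree-`2` form of Verbitsky's `𝔰𝔲(2)` argument (`GenericInducedComplexStructure.lean`:
`IsLinearHyperkaehler.eq_or_eq_neg_of_apply₂_twistorOp_invariant`, `….finite_setOf_apply₂_twistorOp_invariant`,
`….apply₂_I_J_invariant_of_two_twistorOp`; `InvariantTwoFormsTwistorPrimitive.lean`: `….apply₂_twistorOp`) says that a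
`2`-form which is not both `I`- and `J`-invariant is `λ_x`-invariant for at most two, antipodal, unit `x`, while an
`I`- and `J`-invariant one is `λ_x`-invariant for every unit `x`:

* §1 `twistorOp_invariant_of_I_J_invariant` (`S ⊆ Compl_Ω` when `Ω` is `I`- and `J`-invariant),
  `I_J_invariant_of_forall_twistorOp_invariant` (converse: `λ_{(1,0,0)} = I`, `λ_{(0,1,0)} = J`),
  `forall_twistorOp_invariant_iff`;
* §2 `eq_or_eq_neg_of_twistorOp_invariant` (otherwise two unit parameters in `S ∩ Compl_Ω` are equal or antipodal),
  `I_J_invariant_of_two_twistorOp_invariant` (two non-antipodal points of `S` in `Compl_Ω` force `S ⊆ Compl_Ω`);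
* §3 **`finite_or_forall_twistorOp_invariant`** — Lemma 3.2 as printed: the set of unit `x` with `λ_x ∈ Compl_Ω` is
  finite, or it is the whole unit sphere; and the sharper `exists_subset_pair_or_forall` (it is contained in some
  `{x₀, −x₀}`, or it is everything);
* §4 `twistorOp_invariant_iff_of_pos`, `not_forall_twistorOp_invariant_of_pos` — Cor. 5.5 (p.24 L76–77: "If the form
  `Ω` represents a Kähler class in `H^{1,1}(A, ℝ)` then there are no twistor lines passing through `I` in `Compl_Ω`")
  at the level of twistor spheres: for an `I`-invariant, `I`-positive `Ω` and any `J` anticommuting with `I`,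
  `S(I, J) ∩ Compl_Ω = {I, −I}` (the `J`-level statement is the tree's `not_J_invariant_of_pos`);
* §5 `exists_forall_twistorOp_invariant_iff` (for `I`-invariant `Ω`: a twistor sphere through `I` inside `Compl_Ω`
  exists iff some `J` anticommuting with `I` leaves `Ω` invariant — p.26 L26–28: "`Compl_Ω` contains a twistor line
  `S = S(I, J)` if and only if `Ω` is both `I`- and `J`-invariant") and
  **`exists_forall_twistorOp_invariant_iff_finrank_pos_eq_finrank_neg`** — Thm. 5.4's twistor-line clause AT `I`,
  sphere level: such a sphere exists iff `n₊ = n₋` (the tree's g7 criterion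
  `exists_anticommuting_invariant_iff_finrank_pos_eq_finrank_neg` rewritten through §5's first theorem).

Nothing here says HC ∕ HC_CM ∕ HC_AV is proved, or that any object of the cell is hyperholomorphic, rotable or carries a
twistor line; the statements are finite-dimensional linear algebra.

## References
* [BuskinIzadi2020TwistorLinesTori] N. Buskin, E. Izadi, *Twistor lines in the period domain of complex tori*,
  arXiv:1806.07831v2 (2020) = Geom. Dedicata 213 (2021) 21–47 (journal pages unseen by the cell), §1 (p.5 L36–39,
  twistor spheres), §3.2 (p.14 L29–32 `Compl_Ω`; Lemma 3.2 p.14 L42–43; its proof p.15 L3–8), Cor. 5.5 (p.24 L76–77;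
  p.25 L3–9: "Corollary 5.5 is almost clear, since a form `Ω` represents a Kähler class in `H^{1,1}(A, ℝ)` if and only
  if the form `h` associated to `Ω` and `I` is positive definite […], that is, its signature is of the form
  `(2n, 0, 0)` and hence, by Theorem 5.4, the connected component of `Compl_Ω` containing `I` does not contain any
  twistor lines.").
* [Verbitsky1995Trianalytic] M. Verbitsky, *Tri-analytic subvarieties of hyperkaehler manifolds*, GAFA 5 (1995) =
  arXiv:alg-geom/9403006, §2 (the `𝔰𝔲(2)` argument: "there are no more than two `R ∈ S` such that `ad R(α) = 0`. Of
  course, these two elements of `S` are opposite to each other"), as formalised in `GenericInducedComplexStructure.lean`.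
-/

section PartA

open Function Complex
open scoped Matrix

namespace Literature.Geometry.Hyperkaehler.TwistorSphereLocus

variable {E : Type*} [NormedAddCommGroup E] [NormedSpace ℂ E]
variable {W : Type*} [NormedAddCommGroup W] [NormedSpace ℝ W]

/-! ## §1 `S ⊆ Compl_Ω` iff `Ω` is `I`- and `J`-invariant -/

/-- **If `Ω` is `I`- and `J`-invariant, the whole twistor sphere `S(I, J)` lies in `Compl_Ω`**: `Ω(λ_x·, λ_x·) = Ω` for
every unit `x`, `λ_x = x₀ I + x₁ J + x₂ K` (the tree's `IsLinearHyperkaehler.apply₂_twistorOp` for a compatible inner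
product, which exists by `exists_isLinearHyperkaehler_of_anticommuting`). [cite: BuskinIzadi2020TwistorLinesTori, §3.2 Lemma 3.2 (arXiv v2 p.14 L42–43), with p.5 L36–39 and p.14 L29–32] -/
theorem twistorOp_invariant_of_I_J_invariant [FiniteDimensional ℂ E] {J : E →L[ℝ] E} (hJJ : ∀ v, J (J v) = -v)
    (hJI : ∀ v, J (I • v) = -(I • J v)) {Ω : E [⋀^Fin 2]→L[ℝ] W} (hI : ∀ v w : E, Ω ![I • v, I • w] = Ω ![v, w])
    (hJ : ∀ v w : E, Ω ![J v, J w] = Ω ![v, w]) {x : Fin 3 → ℝ} (hx : x 0 ^ 2 + x 1 ^ 2 + x 2 ^ 2 = 1) (v w : E) :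
    Ω ![(x 0 • opI E + x 1 • J + x 2 • opK J) v, (x 0 • opI E + x 1 • J + x 2 • opK J) w] = Ω ![v, w] := by
  obtain ⟨g₀, h⟩ := exists_isLinearHyperkaehler_of_anticommuting hJJ hJI
  rw [h.apply₂_twistorOp hI hJ (x 0) (x 1) (x 2) v w, hx, one_smul]

/-- Conversely, if every point of the twistor sphere lies in `Compl_Ω`, then in particular `I = λ_{(1,0,0)}` and
`J = λ_{(0,1,0)}` do: `Ω` is `I`- and `J`-invariant. [cite: BuskinIzadi2020TwistorLinesTori, §3.2 (arXiv v2 p.14 L29–32, p.5 L36–39)] -/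
theorem I_J_invariant_of_forall_twistorOp_invariant {J : E →L[ℝ] E} {Ω : E [⋀^Fin 2]→L[ℝ] W}
    (hΩ : ∀ x : Fin 3 → ℝ, x 0 ^ 2 + x 1 ^ 2 + x 2 ^ 2 = 1 →
      ∀ v w : E, Ω ![(x 0 • opI E + x 1 • J + x 2 • opK J) v, (x 0 • opI E + x 1 • J + x 2 • opK J) w] = Ω ![v, w]) :
    (∀ v w : E, Ω ![I • v, I • w] = Ω ![v, w]) ∧ ∀ v w : E, Ω ![J v, J w] = Ω ![v, w] := by
  constructor
  · intro v w
    have h := hΩ ![1, 0, 0] (by simp) v w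
    simpa using h
  · intro v w
    have h := hΩ ![0, 1, 0] (by simp) v w
    simpa using h

/-- `S(I, J) ⊆ Compl_Ω` iff `Ω` is `I`- and `J`-invariant. [cite: BuskinIzadi2020TwistorLinesTori, §3.2 Lemma 3.2 (arXiv v2 p.14 L42–43)] -/
theorem forall_twistorOp_invariant_iff [FiniteDimensional ℂ E] {J : E →L[ℝ] E} (hJJ : ∀ v, J (J v) = -v)
    (hJI : ∀ v, J (I • v) = -(I • J v)) (Ω : E [⋀^Fin 2]→L[ℝ] W) :
    (∀ x : Fin 3 → ℝ, x 0 ^ 2 + x 1 ^ 2 + x 2 ^ 2 = 1 →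
      ∀ v w : E, Ω ![(x 0 • opI E + x 1 • J + x 2 • opK J) v, (x 0 • opI E + x 1 • J + x 2 • opK J) w] = Ω ![v, w]) ↔
    (∀ v w : E, Ω ![I • v, I • w] = Ω ![v, w]) ∧ ∀ v w : E, Ω ![J v, J w] = Ω ![v, w] :=
  ⟨I_J_invariant_of_forall_twistorOp_invariant,
    fun h _ hx v w => twistorOp_invariant_of_I_J_invariant hJJ hJI h.1 h.2 hx v w⟩

/-! ## §2 Otherwise at most two, antipodal, points of `S` lie in `Compl_Ω` -/

/-- **Two points of `S(I, J) ∩ Compl_Ω` are equal or antipodal** unless `Ω` is `I`- and `J`-invariant (the tree's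
`IsLinearHyperkaehler.eq_or_eq_neg_of_apply₂_twistorOp_invariant` for a compatible inner product).
[cite: BuskinIzadi2020TwistorLinesTori, §3.2 Lemma 3.2 (arXiv v2 p.14 L42–43)] [cite: Verbitsky1995Trianalytic, §2 ("no more than two R ∈ S … opposite to each other")] -/
theorem eq_or_eq_neg_of_twistorOp_invariant [FiniteDimensional ℂ E] {J : E →L[ℝ] E} (hJJ : ∀ v, J (J v) = -v)
    (hJI : ∀ v, J (I • v) = -(I • J v)) {Ω : E [⋀^Fin 2]→L[ℝ] W}
    (hΩ : ¬ ((∀ v w : E, Ω ![I • v, I • w] = Ω ![v, w]) ∧ ∀ v w : E, Ω ![J v, J w] = Ω ![v, w]))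
    {x y : Fin 3 → ℝ} (hx : x 0 ^ 2 + x 1 ^ 2 + x 2 ^ 2 = 1) (hy : y 0 ^ 2 + y 1 ^ 2 + y 2 ^ 2 = 1)
    (hΩx : ∀ v w : E, Ω ![(x 0 • opI E + x 1 • J + x 2 • opK J) v, (x 0 • opI E + x 1 • J + x 2 • opK J) w]
      = Ω ![v, w])
    (hΩy : ∀ v w : E, Ω ![(y 0 • opI E + y 1 • J + y 2 • opK J) v, (y 0 • opI E + y 1 • J + y 2 • opK J) w]
      = Ω ![v, w]) :
    x = y ∨ x = -y := by
  obtain ⟨g₀, h⟩ := exists_isLinearHyperkaehler_of_anticommuting hJJ hJI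
  exact h.eq_or_eq_neg_of_apply₂_twistorOp_invariant hΩ hx hy hΩx hΩy

/-- **Two non-antipodal points of `S(I, J)` in `Compl_Ω` force `S(I, J) ⊆ Compl_Ω`** (`x × y ≠ 0`: then `Ω` is `I`-
and `J`-invariant; the tree's `IsLinearHyperkaehler.apply₂_I_J_invariant_of_two_twistorOp`).
[cite: BuskinIzadi2020TwistorLinesTori, §3.2 Lemma 3.2 (arXiv v2 p.14 L42–43)] [cite: Verbitsky1995Trianalytic, §2 ("the element a ∈ 𝔰𝔲(2) such that a(v) = 0 is unique up to a constant […]")] -/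
theorem I_J_invariant_of_two_twistorOp_invariant [FiniteDimensional ℂ E] {J : E →L[ℝ] E} (hJJ : ∀ v, J (J v) = -v)
    (hJI : ∀ v, J (I • v) = -(I • J v)) {Ω : E [⋀^Fin 2]→L[ℝ] W} {x y : Fin 3 → ℝ}
    (hx : x 0 ^ 2 + x 1 ^ 2 + x 2 ^ 2 = 1) (hy : y 0 ^ 2 + y 1 ^ 2 + y 2 ^ 2 = 1) (hxy : x ⨯₃ y ≠ 0)
    (hΩx : ∀ v w : E, Ω ![(x 0 • opI E + x 1 • J + x 2 • opK J) v, (x 0 • opI E + x 1 • J + x 2 • opK J) w]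
      = Ω ![v, w])
    (hΩy : ∀ v w : E, Ω ![(y 0 • opI E + y 1 • J + y 2 • opK J) v, (y 0 • opI E + y 1 • J + y 2 • opK J) w]
      = Ω ![v, w]) :
    (∀ v w : E, Ω ![I • v, I • w] = Ω ![v, w]) ∧ ∀ v w : E, Ω ![J v, J w] = Ω ![v, w] := by
  obtain ⟨g₀, h⟩ := exists_isLinearHyperkaehler_of_anticommuting hJJ hJI
  exact h.apply₂_I_J_invariant_of_two_twistorOp hx hy hxy hΩx hΩy

/-! ## §3 Lemma 3.2 -/

/-- **[BI20] Lemma 3.2.** "For any alternating form `Ω` and any twistor sphere `S`, the intersection `S ∩ Compl_Ω` is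
either finite or all of `S`": for `S = S(I, J)` parametrised by the unit sphere of `ℝ³` (`x ↦ λ_x = x₀I + x₁J + x₂K`)
and `Compl_Ω = {L | Ω(L·, L·) = Ω}`, the set of unit parameters `x` with `λ_x ∈ Compl_Ω` is finite, or it is the whole
unit sphere. (Printed proof: both are complex analytic subsets of `Compl`; here: the `𝔰𝔲(2)` argument of §2.)
[cite: BuskinIzadi2020TwistorLinesTori, §3.2 Lemma 3.2 (arXiv v2 p.14 L42–43; proof p.15 L3–8)] -/
theorem finite_or_forall_twistorOp_invariant [FiniteDimensional ℂ E] {J : E →L[ℝ] E} (hJJ : ∀ v, J (J v) = -v)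
    (hJI : ∀ v, J (I • v) = -(I • J v)) (Ω : E [⋀^Fin 2]→L[ℝ] W) :
    {x : Fin 3 → ℝ | x 0 ^ 2 + x 1 ^ 2 + x 2 ^ 2 = 1 ∧
      ∀ v w : E, Ω ![(x 0 • opI E + x 1 • J + x 2 • opK J) v, (x 0 • opI E + x 1 • J + x 2 • opK J) w]
        = Ω ![v, w]}.Finite ∨
    ∀ x : Fin 3 → ℝ, x 0 ^ 2 + x 1 ^ 2 + x 2 ^ 2 = 1 →
      ∀ v w : E, Ω ![(x 0 • opI E + x 1 • J + x 2 • opK J) v, (x 0 • opI E + x 1 • J + x 2 • opK J) w] = Ω ![v, w] := by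
  by_cases hΩ : (∀ v w : E, Ω ![I • v, I • w] = Ω ![v, w]) ∧ ∀ v w : E, Ω ![J v, J w] = Ω ![v, w]
  · exact Or.inr fun x hx v w => twistorOp_invariant_of_I_J_invariant hJJ hJI hΩ.1 hΩ.2 hx v w
  · obtain ⟨g₀, h⟩ := exists_isLinearHyperkaehler_of_anticommuting hJJ hJI
    exact Or.inl (h.finite_setOf_apply₂_twistorOp_invariant hΩ)

/-- **Lemma 3.2, sharpened**: `S(I, J) ∩ Compl_Ω` is contained in a pair of antipodal points `{λ_{x₀}, λ_{−x₀}}`, or it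
is all of `S(I, J)`. [cite: BuskinIzadi2020TwistorLinesTori, §3.2 Lemma 3.2 (arXiv v2 p.14 L42–43)] [cite: Verbitsky1995Trianalytic, §2 ("no more than two R ∈ S … opposite to each other")] -/
theorem exists_subset_pair_or_forall [FiniteDimensional ℂ E] {J : E →L[ℝ] E} (hJJ : ∀ v, J (J v) = -v)
    (hJI : ∀ v, J (I • v) = -(I • J v)) (Ω : E [⋀^Fin 2]→L[ℝ] W) :
    (∃ x₀ : Fin 3 → ℝ, {x : Fin 3 → ℝ | x 0 ^ 2 + x 1 ^ 2 + x 2 ^ 2 = 1 ∧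
      ∀ v w : E, Ω ![(x 0 • opI E + x 1 • J + x 2 • opK J) v, (x 0 • opI E + x 1 • J + x 2 • opK J) w]
        = Ω ![v, w]} ⊆ {x₀, -x₀}) ∨
    ∀ x : Fin 3 → ℝ, x 0 ^ 2 + x 1 ^ 2 + x 2 ^ 2 = 1 →
      ∀ v w : E, Ω ![(x 0 • opI E + x 1 • J + x 2 • opK J) v, (x 0 • opI E + x 1 • J + x 2 • opK J) w] = Ω ![v, w] := by
  by_cases hΩ : (∀ v w : E, Ω ![I • v, I • w] = Ω ![v, w]) ∧ ∀ v w : E, Ω ![J v, J w] = Ω ![v, w]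
  · exact Or.inr fun x hx v w => twistorOp_invariant_of_I_J_invariant hJJ hJI hΩ.1 hΩ.2 hx v w
  · refine Or.inl ?_
    by_cases hS : {x : Fin 3 → ℝ | x 0 ^ 2 + x 1 ^ 2 + x 2 ^ 2 = 1 ∧
        ∀ v w : E, Ω ![(x 0 • opI E + x 1 • J + x 2 • opK J) v, (x 0 • opI E + x 1 • J + x 2 • opK J) w]
          = Ω ![v, w]}.Nonempty
    · obtain ⟨x₀, hx₀, hΩx₀⟩ := hS
      refine ⟨x₀, fun x hx => ?_⟩
      rcases eq_or_eq_neg_of_twistorOp_invariant hJJ hJI hΩ hx.1 hx₀ hx.2 hΩx₀ with e | e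
      · exact Or.inl e
      · exact Or.inr e
    · exact ⟨0, by rw [Set.not_nonempty_iff_eq_empty.1 hS]; exact Set.empty_subset _⟩

/-! ## §4 Cor. 5.5 at the level of twistor spheres: a Kähler `Ω` meets each `S(I, J)` only in `±I` -/

/-- **[BI20] Cor. 5.5, twistor-sphere form.** If `Ω` is `I`-invariant and `I`-POSITIVE (`Ω(v, Iv) > 0` for `v ≠ 0`:
"a form `Ω` represents a Kähler class in `H^{1,1}(A, ℝ)` if and only if the form `h` associated to `Ω` and `I` is
positive definite", p.25 L5–6) on a non-zero space, then for EVERY complex structure `J` anticommuting with `I` the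
unit parameters `x` with `λ_x ∈ Compl_Ω` are exactly `(±1, 0, 0)`, i.e. `S(I, J) ∩ Compl_Ω = {I, −I}` — in
particular no twistor sphere through `I` lies in `Compl_Ω`: "If the form `Ω` represents a Kähler class in
`H^{1,1}(A, ℝ)` then there are no twistor lines passing through `I` in `Compl_Ω`" (Cor. 5.5, p.24 L76–77). The
`J`-level statement is the tree's `not_J_invariant_of_pos`. [cite: BuskinIzadi2020TwistorLinesTori, Cor. 5.5 (arXiv v2 p.24 L76–77; p.25 L3–9) with Lemma 3.2 (p.14 L42–43)] -/
theorem twistorOp_invariant_iff_of_pos [FiniteDimensional ℂ E] [Nontrivial E] {J : E →L[ℝ] E}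
    (hJJ : ∀ v, J (J v) = -v) (hJI : ∀ v, J (I • v) = -(I • J v)) {Ω : E [⋀^Fin 2]→L[ℝ] ℝ}
    (hI : ∀ v w : E, Ω ![I • v, I • w] = Ω ![v, w]) (hpos : ∀ v : E, v ≠ 0 → 0 < Ω ![v, I • v])
    {x : Fin 3 → ℝ} (hx : x 0 ^ 2 + x 1 ^ 2 + x 2 ^ 2 = 1) :
    (∀ v w : E, Ω ![(x 0 • opI E + x 1 • J + x 2 • opK J) v, (x 0 • opI E + x 1 • J + x 2 • opK J) w] = Ω ![v, w]) ↔
      x = ![1, 0, 0] ∨ x = -![1, 0, 0] := by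
  have hΩ : ¬ ((∀ v w : E, Ω ![I • v, I • w] = Ω ![v, w]) ∧ ∀ v w : E, Ω ![J v, J w] = Ω ![v, w]) :=
    fun h => not_J_invariant_of_pos hJJ hJI hpos h.2
  have he : (![1, 0, 0] : Fin 3 → ℝ) 0 ^ 2 + (![1, 0, 0] : Fin 3 → ℝ) 1 ^ 2 + (![1, 0, 0] : Fin 3 → ℝ) 2 ^ 2 = 1 := by
    simp
  have hIe : ∀ v w : E, Ω ![((![1, 0, 0] : Fin 3 → ℝ) 0 • opI E + (![1, 0, 0] : Fin 3 → ℝ) 1 • J +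
      (![1, 0, 0] : Fin 3 → ℝ) 2 • opK J) v, ((![1, 0, 0] : Fin 3 → ℝ) 0 • opI E + (![1, 0, 0] : Fin 3 → ℝ) 1 • J +
      (![1, 0, 0] : Fin 3 → ℝ) 2 • opK J) w] = Ω ![v, w] := fun v w => by
    simpa using hI v w
  constructor
  · intro hΩx
    exact eq_or_eq_neg_of_twistorOp_invariant hJJ hJI hΩ hx he hΩx hIe
  · rintro (rfl | rfl) v w
    · exact hIe v w
    · have h : Ω ![-(I • v), -(I • w)] = Ω ![v, w] := by
        rw [Literature.Geometry.Hyperkaehler.apply₂_neg_left, Literature.Geometry.Hyperkaehler.apply₂_neg_right,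
          neg_neg, hI]
      simpa using h

/-- Hence **no twistor sphere through `I` lies in `Compl_Ω` for a Kähler `Ω`** ("there are no twistor lines passing
through `I` in `Compl_Ω`"): for every `J` anticommuting with `I`, some point of `S(I, J)` — e.g. `J = λ_{(0,1,0)}`
itself — is outside `Compl_Ω`. [cite: BuskinIzadi2020TwistorLinesTori, Cor. 5.5 (arXiv v2 p.24 L76–77)] -/
theorem not_forall_twistorOp_invariant_of_pos [FiniteDimensional ℂ E] [Nontrivial E] {J : E →L[ℝ] E}
    (hJJ : ∀ v, J (J v) = -v) (hJI : ∀ v, J (I • v) = -(I • J v)) {Ω : E [⋀^Fin 2]→L[ℝ] ℝ}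
    (hpos : ∀ v : E, v ≠ 0 → 0 < Ω ![v, I • v]) :
    ¬ ∀ x : Fin 3 → ℝ, x 0 ^ 2 + x 1 ^ 2 + x 2 ^ 2 = 1 →
      ∀ v w : E, Ω ![(x 0 • opI E + x 1 • J + x 2 • opK J) v, (x 0 • opI E + x 1 • J + x 2 • opK J) w] = Ω ![v, w] :=
  fun h => not_J_invariant_of_pos hJJ hJI hpos (I_J_invariant_of_forall_twistorOp_invariant h).2

/-! ## §5 Thm. 5.4's twistor-line clause at `I`, sphere level: a twistor sphere through `I` inside `Compl_Ω` exists
iff `n₊ = n₋` -/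

/-- For an `I`-invariant `Ω`: **some twistor sphere `S(I, J)` through `I` lies in `Compl_Ω` iff some complex structure
`J` anticommuting with `I` leaves `Ω` invariant** (§1: `S(I, J) ⊆ Compl_Ω` iff `Ω` is `I`- and `J`-invariant) —
"`Compl_Ω` contains a twistor line `S = S(I, J)` if and only if `Ω` is both `I`- and `J`-invariant, that is,
`I, J ∈ Compl_Ω`" (p.26 L26–28). [cite: BuskinIzadi2020TwistorLinesTori, §5 proof of Thm. 5.4 (arXiv v2 p.26 L26–28) with Lemma 3.2 (p.14 L42–43)] -/
theorem exists_forall_twistorOp_invariant_iff [FiniteDimensional ℂ E] {Ω : E [⋀^Fin 2]→L[ℝ] W}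
    (hI : ∀ v w : E, Ω ![I • v, I • w] = Ω ![v, w]) :
    (∃ J : E →L[ℝ] E, (∀ v, J (J v) = -v) ∧ (∀ v, J (I • v) = -(I • J v)) ∧
      ∀ x : Fin 3 → ℝ, x 0 ^ 2 + x 1 ^ 2 + x 2 ^ 2 = 1 →
        ∀ v w : E, Ω ![(x 0 • opI E + x 1 • J + x 2 • opK J) v, (x 0 • opI E + x 1 • J + x 2 • opK J) w]
          = Ω ![v, w]) ↔
    ∃ J : E →L[ℝ] E, (∀ v, J (J v) = -v) ∧ (∀ v, J (I • v) = -(I • J v)) ∧ ∀ v w : E, Ω ![J v, J w] = Ω ![v, w] :=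
  ⟨fun ⟨J, hJJ, hJI, hS⟩ => ⟨J, hJJ, hJI, (I_J_invariant_of_forall_twistorOp_invariant hS).2⟩,
    fun ⟨J, hJJ, hJI, hJ⟩ => ⟨J, hJJ, hJI, fun _ hx v w => twistorOp_invariant_of_I_J_invariant hJJ hJI hI hJ hx v w⟩⟩

/-- **[BI20] Thm. 5.4, twistor-line clause, pointwise at the level of twistor spheres**: for an `I`-invariant real
`2`-covector `Ω` on an even-dimensional complex space `(V_ℝ, I) = E` with complex-maximal `h`-positive ∕ `h`-negative
subspaces `P`, `N` (`n₊ = dim_ℂ P`, `n₋ = dim_ℂ N`), a twistor sphere `S(I, J)` through `I` contained in `Compl_Ω`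
EXISTS iff `n₊ = n₋` ("If `n₀` is even, there is precisely one connected component of `Compl^±_Ω` that contains twistor
lines. This component is `Sign⁻¹(n − n₀/2, n − n₀/2, n₀)` […]. If `n₀` is odd, there are no connected components of
`Compl^±_Ω` containing a twistor line.", p.24 L64–74 — here only the criterion AT `I`; the tree's
`exists_anticommuting_invariant_iff_finrank_pos_eq_finrank_neg` read through `exists_forall_twistorOp_invariant_iff`).
[cite: BuskinIzadi2020TwistorLinesTori, Thm. 5.4 (arXiv v2 p.24 L54–74; proof p.26 L26–p.27 L7) with Lemma 3.2 (p.14 L42–43)] -/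
theorem exists_forall_twistorOp_invariant_iff_finrank_pos_eq_finrank_neg [FiniteDimensional ℂ E]
    {Ω : E [⋀^Fin 2]→L[ℝ] ℝ} (hI : ∀ v w : E, Ω ![I • v, I • w] = Ω ![v, w]) (hE : Even (finrank ℂ E))
    {P N : Submodule ℂ E} (hP : ∀ v ∈ P, v ≠ 0 → 0 < Ω ![v, I • v])
    (hPmax : ∀ Q : Submodule ℂ E, (∀ v ∈ Q, v ≠ 0 → 0 < Ω ![v, I • v]) → finrank ℂ Q ≤ finrank ℂ P)
    (hN : ∀ v ∈ N, v ≠ 0 → Ω ![v, I • v] < 0)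
    (hNmax : ∀ Q : Submodule ℂ E, (∀ v ∈ Q, v ≠ 0 → Ω ![v, I • v] < 0) → finrank ℂ Q ≤ finrank ℂ N) :
    (∃ J : E →L[ℝ] E, (∀ v, J (J v) = -v) ∧ (∀ v, J (I • v) = -(I • J v)) ∧
      ∀ x : Fin 3 → ℝ, x 0 ^ 2 + x 1 ^ 2 + x 2 ^ 2 = 1 →
        ∀ v w : E, Ω ![(x 0 • opI E + x 1 • J + x 2 • opK J) v, (x 0 • opI E + x 1 • J + x 2 • opK J) w]
          = Ω ![v, w]) ↔
    finrank ℂ P = finrank ℂ N := by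
  rw [exists_forall_twistorOp_invariant_iff hI]
  exact exists_anticommuting_invariant_iff_finrank_pos_eq_finrank_neg hI hE hP hPmax hN hNmax

end Literature.Geometry.Hyperkaehler.TwistorSphereLocus

end PartA

/-!
## Part B — standalone draft `TwistorLineSignatureSylvester.v3` (sha256∕16 875f127124522f79), reproduced verbatim below
(its module docstring first: references to "this file" ∕ "this leaf" mean this Part; items it lists as
"NOT here" may be supplied by other Parts — see the file header; then its code, byte-identical).

# [BI20] Thm. 5.4's signature criterion in Sylvester's vocabulary: a twistor line through `I` in `Compl_Ω` exists
# (at the linear-algebra level: a `J` with `J² = −1`, `JI = −IJ`, `Ω(J·, J·) = Ω`) iff `sigPos q = sigNeg q` for the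
# REAL quadratic form `q(u) = h(u, u) = Ω(u, Iu)`

[BI20] = Buskin–Izadi, *Twistor lines in the period domain of complex tori*, arXiv:1806.07831v2, §5. The printed
signature of the hermitian form associated to `Ω` and `I` (v2 p.23 L20–30: "Let `I` be a complex structure operator in
`Compl_Ω`, that is, `Ω(Iu, Iv) = Ω(u, v)` for all `u, v ∈ V_ℝ`. On the vector space `(V_ℝ, I)`, considered as a complex
vector space, the form `Ω` determines a hermitian form `h(u, v) := Ω(u, Iv) − iΩ(u, v)` […]. The signature of `h` is a
triple `(n₊, n₋, n₀)`, where `n₊`, `n₋` and `n₀` are the complex dimensions of, respectively, a maximal positive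
subspace `V₊`, a maximal negative subspace `V₋`, and the null subspace
`V₀ = {u ∈ V_ℝ | h(u, v) = 0 for all v ∈ V_ℝ} = {u ∈ V_ℝ | Ω(u, v) = 0 for all v ∈ V_ℝ}` of `h` in `(V_ℝ, I)`, so that
`n₊ + n₋ + n₀ = 2n`.") and Theorem 5.4's twistor-line clause (p.24 L54–74: "[…] If `n₀` is even, there is precisely one
connected component of `Compl^±_Ω` that contains twistor lines. This component is `Sign⁻¹(n − n₀/2, n − n₀/2, n₀)` and
is twistor path connected. If `n₀` is odd, there are no connected components of `Compl^±_Ω` containing a twistor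
line.") are in the tree as `Literature/Geometry/Hyperkaehler/TwistorLineHermitianFormSignature.lean` (this lineage,
g7), which reads `n₊`, `n₋` exactly as printed — the largest COMPLEX dimensions of `h`-positive ∕ `h`-negative complex
subspaces of `(V_ℝ, I) = E` — and proves the pointwise criterion `exists_anticommuting_invariant_iff_finrank_pos_eq_finrank_neg`
(a `J` with `J² = −1`, `JI = −IJ`, `Ω(J·, J·) = Ω` exists iff `n₊ = n₋`).

Mathlib has since acquired Sylvester's law of inertia for quadratic forms over ordered fields
(`Mathlib.LinearAlgebra.QuadraticForm.Signature`: `sigPos q` ∕ `sigNeg q` = the largest dimension of a subspace on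
which `q` is positive ∕ negative definite, `QuadraticForm.sigPos_add_sigNeg_add_radical`). This leaf states the same
criterion through that canonical vocabulary, for the REAL quadratic form `q(u) = h(u, u) = Ω(u, Iu)` on the real
vector space underlying `E` — so the printed `(n₊, n₋, n₀)` is `(sigPos q ∕ 2, sigNeg q ∕ 2, dim_ℝ rad q ∕ 2)`:

* §1 `exists_quadraticForm_smul` — the real quadratic form `q` with `q u = Ω(u, Iu)` exists;
* §2 `finrank_real_le_two_mul_card_pos` — a REAL subspace on which `h > 0` has real dimension `≤ 2 · #{k : d_k > 0}`
  for any `h`-orthogonal complex frame with diagonal `d` (the tree's `finrank_le_card_pos` is the complex-subspace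
  version); `exists_real_pos_submodule_finrank_eq` — equality is attained (the complex span of the positive frame
  vectors, restricted to `ℝ`); hence **`sigPos_eq_two_mul_card_pos`**: `sigPos q = 2 · #{k : d_k > 0}`, and by the sign
  flip `Ω ↦ −Ω` **`sigNeg_eq_two_mul_card_neg`**: `sigNeg q = 2 · #{k : d_k < 0}`; `sigPos_eq_two_mul_finrank_of_maximal`
  ∕ `sigNeg_eq_two_mul_finrank_of_maximal` — `sigPos q = 2 n₊`, `sigNeg q = 2 n₋` for the tree's complex-maximal
  readings of `n₊`, `n₋`; `finrank_radical_eq_two_mul_card_null` — `dim_ℝ rad q = 2 · #{k : d_k = 0}` (`= 2 n₀`);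
* §3 **`exists_anticommuting_invariant_iff_sigPos_eq_sigNeg`** — for an `I`-invariant `Ω` on an even-dimensional
  complex space: `(∃ J, J² = −1 ∧ JI = −IJ ∧ Ω(J·, J·) = Ω) ↔ sigPos q = sigNeg q`; and
  `exists_isLinearHyperkaehler_invariant_of_sigPos_eq_sigNeg` — then even a linear hyperkähler structure `(g₀, I, J, K)`
  with `Ω` `J`-invariant exists (the tree's `exists_isLinearHyperkaehler_invariant_of_finrank_pos_eq_finrank_neg`).

Nothing here says HC ∕ HC_CM ∕ HC_AV is proved, or that any object of the cell is hyperholomorphic, rotable or carries a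
twistor line; the statements are finite-dimensional linear algebra.

## References
* [BuskinIzadi2020TwistorLinesTori] N. Buskin, E. Izadi, *Twistor lines in the period domain of complex tori*,
  arXiv:1806.07831v2 (2020), §5 (p.23 L20–30 the hermitian form `h` and its signature; Thm. 5.4 p.24 L54–74; proof of
  its twistor-line clause "The component containing a twistor line" p.26 L26–p.27 L7). Locators "p.N Lm" = PDF
  page N, text-layer line m of the v2 PDF (the lineage's dump `widen/LIT-W/texts-verbitsky/bi20v2/dump/`).
* [GohbergLancasterRodman2005] I. Gohberg, P. Lancaster, L. Rodman, *Indefinite Linear Algebra and Applications*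
  (2005), §2.3 Thm. 2.3.2 (inertia indices as maximal dimensions of definite subspaces).
-/

section PartB

open Complex Function Module Literature.LinearAlgebra.Alternating

namespace Literature.Geometry.Hyperkaehler.TwistorLineSylvester

variable {E : Type*} [NormedAddCommGroup E] [NormedSpace ℂ E]

/-! ## §1 The real quadratic form `q(u) = h(u, u) = Ω(u, Iu)` -/

/-- The real bilinear form `(u, v) ↦ Ω(u, Iv)` (real part of `h`). [cite: BuskinIzadi2020TwistorLinesTori, §5 (arXiv v2 p.23 L20–25)] -/
theorem exists_bilinForm_smul (Ω : E [⋀^Fin 2]→L[ℝ] ℝ) :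
    ∃ B : E →ₗ[ℝ] E →ₗ[ℝ] ℝ, ∀ u v, B u v = Ω ![u, I • v] :=
  ⟨LinearMap.mk₂ ℝ (fun u v => Ω ![u, I • v]) (fun u₁ u₂ v => apply₂_add_left Ω u₁ u₂ (I • v))
    (fun c u v => apply₂_smul_left Ω c u (I • v)) (fun u v₁ v₂ => by simp only [smul_add, apply₂_add_right])
    (fun c u v => by simp only [smul_comm I c v, apply₂_smul_right]), fun _ _ => rfl⟩

/-- **The real quadratic form `q(u) = h(u, u) = Ω(u, Iu)`** of the hermitian form `h` associated to `Ω` and `I`, on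
the real vector space underlying `E`. [cite: BuskinIzadi2020TwistorLinesTori, §5 (arXiv v2 p.23 L20–25)] -/
theorem exists_quadraticForm_smul (Ω : E [⋀^Fin 2]→L[ℝ] ℝ) :
    ∃ q : QuadraticForm ℝ E, ∀ u, q u = Ω ![u, I • u] := by
  obtain ⟨B, hB⟩ := exists_bilinForm_smul Ω
  exact ⟨LinearMap.BilinMap.toQuadraticMap B, fun u => by rw [LinearMap.BilinMap.toQuadraticMap_apply, hB]⟩

/-! ## §2 `sigPos q = 2 · #{k : d_k > 0}`, `sigNeg q = 2 · #{k : d_k < 0}` in any `h`-orthogonal complex frame -/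

section Frame

variable {ι : Type*} [Fintype ι] [DecidableEq ι]

omit [DecidableEq ι] in
/-- `dim_ℝ (ι' → ℂ) = 2 · #ι'`. [folklore] -/
private theorem finrank_real_pi_complex {ι' : Type*} [Fintype ι'] : finrank ℝ (ι' → ℂ) = 2 * Fintype.card ι' := by
  rw [Module.finrank_pi_fintype ℝ, Finset.sum_const, Finset.card_univ, Complex.finrank_real_complex, smul_eq_mul,
    mul_comm]

/-- **Inertia over `ℝ`, upper bound**: a REAL subspace of `E` on which `h(u, u) = Ω(u, Iu) > 0` has real dimension at
most `2 · #{k : d_k > 0}` for any `h`-orthogonal complex frame `b` with `h(b_k, b_l) = d_k δ_{kl}` (it meets the real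
span of the non-positive frame vectors and their `I`-multiples trivially). The complex-subspace version is the tree's
`finrank_le_card_pos`. [cite: GohbergLancasterRodman2005, §2.3 Thm. 2.3.2] [cite: BuskinIzadi2020TwistorLinesTori, §5 (arXiv v2 p.23 L26–28: "a maximal positive subspace V₊")] -/
theorem finrank_real_le_two_mul_card_pos {Ω : E [⋀^Fin 2]→L[ℝ] ℝ} (hΩI : ∀ u v : E, Ω ![I • u, I • v] = Ω ![u, v])
    (b : Module.Basis ι ℂ E) {d : ι → ℝ} (hb₁ : ∀ k l, Ω ![b k, I • b l] = if k = l then d k else 0)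
    (hb₂ : ∀ k l, Ω ![b k, b l] = 0) {Q : Submodule ℝ E} (hQ : ∀ v ∈ Q, v ≠ 0 → 0 < Ω ![v, I • v]) :
    finrank ℝ Q ≤ 2 * Fintype.card {i // 0 < d i} := by
  classical
  haveI : FiniteDimensional ℂ E := Module.Finite.of_basis b
  haveI : FiniteDimensional ℝ E := FiniteDimensional.complexToReal E
  let πℂ : E →ₗ[ℂ] ({i // 0 < d i} → ℂ) :=
    { toFun := fun u i ↦ b.equivFun u i.1
      map_add' := fun u v ↦ by ext i; simp only [map_add, Pi.add_apply]
      map_smul' := fun c u ↦ by ext i; simp only [map_smul, Pi.smul_apply, RingHom.id_apply] }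
  let π : E →ₗ[ℝ] ({i // 0 < d i} → ℂ) := πℂ.restrictScalars ℝ
  have hπ : ∀ u i, π u i = b.equivFun u i.1 := fun _ _ ↦ rfl
  have hinf : Q ⊓ LinearMap.ker π = ⊥ := by
    rw [Submodule.eq_bot_iff]
    rintro u ⟨huQ, huK⟩
    by_contra hu
    have hpos := hQ u huQ hu
    rw [apply₂_self_I_eq_sum hΩI b hb₁ hb₂] at hpos
    have hz : ∀ k, 0 < d k → b.equivFun u k = 0 := fun k hk ↦ by
      have e := congr_fun (LinearMap.mem_ker.mp huK) ⟨k, hk⟩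
      rwa [hπ] at e
    have hle : ∑ k, d k * Complex.normSq (b.equivFun u k) ≤ 0 := by
      refine Finset.sum_nonpos fun k _ ↦ ?_
      by_cases hk : 0 < d k
      · rw [hz k hk, map_zero, mul_zero]
      · exact mul_nonpos_of_nonpos_of_nonneg (not_lt.mp hk) (Complex.normSq_nonneg _)
    exact absurd hpos (not_lt.mpr hle)
  have h1 := Submodule.finrank_sup_add_finrank_inf_eq Q (LinearMap.ker π)
  rw [hinf, finrank_bot, add_zero] at h1
  have h2 := LinearMap.finrank_range_add_finrank_ker π
  have h3 : finrank ℝ (LinearMap.range π) ≤ 2 * Fintype.card {i // 0 < d i} :=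
    (Submodule.finrank_le _).trans (finrank_real_pi_complex (ι' := {i // 0 < d i})).le
  have h4 := Submodule.finrank_le (Q ⊔ LinearMap.ker π)
  omega

/-- **Inertia over `ℝ`, attained**: there is a real subspace on which `h > 0` of real dimension exactly
`2 · #{k : d_k > 0}` (the complex span of the positive frame vectors — the tree's `exists_pos_submodule_finrank_eq_card`
— regarded as a real subspace). [cite: GohbergLancasterRodman2005, §2.3 Thm. 2.3.2] [cite: BuskinIzadi2020TwistorLinesTori, §5 (arXiv v2 p.23 L26–30)] -/
theorem exists_real_pos_submodule_finrank_eq {Ω : E [⋀^Fin 2]→L[ℝ] ℝ}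
    (hΩI : ∀ u v : E, Ω ![I • u, I • v] = Ω ![u, v]) (b : Module.Basis ι ℂ E) {d : ι → ℝ}
    (hb₁ : ∀ k l, Ω ![b k, I • b l] = if k = l then d k else 0) (hb₂ : ∀ k l, Ω ![b k, b l] = 0) :
    ∃ P : Submodule ℝ E, (∀ v ∈ P, v ≠ 0 → 0 < Ω ![v, I • v]) ∧
      finrank ℝ P = 2 * Fintype.card {i // 0 < d i} := by
  haveI : FiniteDimensional ℂ E := Module.Finite.of_basis b
  obtain ⟨P₀, hP₀, hP₀d⟩ := exists_pos_submodule_finrank_eq_card hΩI b hb₁ hb₂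
  refine ⟨P₀.restrictScalars ℝ, fun v hv hv0 => hP₀ v hv hv0, ?_⟩
  have h := Module.finrank_mul_finrank ℝ ℂ P₀
  rw [Complex.finrank_real_complex, hP₀d] at h
  exact (show finrank ℝ (P₀.restrictScalars ℝ) = finrank ℝ P₀ from rfl).trans h.symm

/-- **`sigPos q = 2 · #{k : d_k > 0}`**: Mathlib's positive index of inertia of the real quadratic form
`q(u) = Ω(u, Iu)` is twice the number of positive diagonal entries of any `h`-orthogonal complex frame — the printed
`n₊`, doubled as a real dimension. [cite: BuskinIzadi2020TwistorLinesTori, §5 (arXiv v2 p.23 L26–30)] [cite: GohbergLancasterRodman2005, §2.3 Thm. 2.3.2] -/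
theorem sigPos_eq_two_mul_card_pos [FiniteDimensional ℂ E] {Ω : E [⋀^Fin 2]→L[ℝ] ℝ}
    (hΩI : ∀ u v : E, Ω ![I • u, I • v] = Ω ![u, v]) (b : Module.Basis ι ℂ E) {d : ι → ℝ}
    (hb₁ : ∀ k l, Ω ![b k, I • b l] = if k = l then d k else 0) (hb₂ : ∀ k l, Ω ![b k, b l] = 0)
    {q : QuadraticForm ℝ E} (hq : ∀ u, q u = Ω ![u, I • u]) :
    sigPos q = 2 * Fintype.card {i // 0 < d i} := by
  haveI : FiniteDimensional ℝ E := FiniteDimensional.complexToReal E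
  apply le_antisymm
  · obtain ⟨V, hV, hpos⟩ := exists_finrank_eq_sigPos_and_posDef q
    rw [← hV]
    refine finrank_real_le_two_mul_card_pos hΩI b hb₁ hb₂ fun u hu hu0 => ?_
    have h := hpos ⟨u, hu⟩ (fun h => hu0 (congrArg Subtype.val h))
    rwa [QuadraticMap.restrict_apply, hq] at h
  · obtain ⟨P, hP, hPd⟩ := exists_real_pos_submodule_finrank_eq hΩI b hb₁ hb₂
    rw [← hPd]
    refine le_sigPos_of_posDef q fun x hx => ?_
    rw [QuadraticMap.restrict_apply, hq]
    exact hP x x.2 fun h => hx (Subtype.ext h)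

/-- **`sigNeg q = 2 · #{k : d_k < 0}`** (the previous statement for `−Ω`, whose quadratic form is `−q`): the printed
`n₋`, doubled. [cite: BuskinIzadi2020TwistorLinesTori, §5 (arXiv v2 p.23 L26–30)] [cite: GohbergLancasterRodman2005, §2.3 Thm. 2.3.2] -/
theorem sigNeg_eq_two_mul_card_neg [FiniteDimensional ℂ E] {Ω : E [⋀^Fin 2]→L[ℝ] ℝ}
    (hΩI : ∀ u v : E, Ω ![I • u, I • v] = Ω ![u, v]) (b : Module.Basis ι ℂ E) {d : ι → ℝ}
    (hb₁ : ∀ k l, Ω ![b k, I • b l] = if k = l then d k else 0) (hb₂ : ∀ k l, Ω ![b k, b l] = 0)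
    {q : QuadraticForm ℝ E} (hq : ∀ u, q u = Ω ![u, I • u]) :
    sigNeg q = 2 * Fintype.card {i // d i < 0} := by
  have hΩI' : ∀ u v : E, (-Ω) ![I • u, I • v] = (-Ω) ![u, v] := fun u v ↦ by
    simp only [ContinuousAlternatingMap.neg_apply, hΩI]
  have hb₁' : ∀ k l, (-Ω) ![b k, I • b l] = if k = l then -d k else 0 := fun k l ↦ by
    rw [ContinuousAlternatingMap.neg_apply, hb₁]; split_ifs <;> simp
  have hb₂' : ∀ k l, (-Ω) ![b k, b l] = 0 := fun k l ↦ by rw [ContinuousAlternatingMap.neg_apply, hb₂, neg_zero]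
  have hq' : ∀ u, (-q) u = (-Ω) ![u, I • u] := fun u ↦ by
    rw [QuadraticMap.neg_apply, ContinuousAlternatingMap.neg_apply, hq]
  have h := sigPos_eq_two_mul_card_pos hΩI' b hb₁' hb₂' hq'
  rw [show sigNeg q = sigPos (-q) from rfl, h]
  congr 1
  exact Fintype.card_congr (Equiv.subtypeEquivRight fun i ↦ by simp)

/-- **`sigPos q = 2 n₊`** for the tree's reading of `n₊` = the largest complex dimension of an `h`-positive complex
subspace `P` (the tree's `card_pos_eq_finrank_of_maximal`). [cite: BuskinIzadi2020TwistorLinesTori, §5 (arXiv v2 p.23 L26–30)] -/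
theorem sigPos_eq_two_mul_finrank_of_maximal [FiniteDimensional ℂ E] {Ω : E [⋀^Fin 2]→L[ℝ] ℝ}
    (hΩI : ∀ u v : E, Ω ![I • u, I • v] = Ω ![u, v]) {q : QuadraticForm ℝ E} (hq : ∀ u, q u = Ω ![u, I • u])
    {P : Submodule ℂ E} (hP : ∀ v ∈ P, v ≠ 0 → 0 < Ω ![v, I • v])
    (hPmax : ∀ Q : Submodule ℂ E, (∀ v ∈ Q, v ≠ 0 → 0 < Ω ![v, I • v]) → finrank ℂ Q ≤ finrank ℂ P) :
    sigPos q = 2 * finrank ℂ P := by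
  classical
  obtain ⟨b, d, hb₁, hb₂⟩ := exists_orthogonal_frame hΩI
  rw [sigPos_eq_two_mul_card_pos hΩI b hb₁ hb₂ hq, card_pos_eq_finrank_of_maximal hΩI b hb₁ hb₂ hP hPmax]

/-- **`sigNeg q = 2 n₋`** for the tree's reading of `n₋` = the largest complex dimension of an `h`-negative complex
subspace `N` (the tree's `card_neg_eq_finrank_of_maximal`). [cite: BuskinIzadi2020TwistorLinesTori, §5 (arXiv v2 p.23 L26–30)] -/
theorem sigNeg_eq_two_mul_finrank_of_maximal [FiniteDimensional ℂ E] {Ω : E [⋀^Fin 2]→L[ℝ] ℝ}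
    (hΩI : ∀ u v : E, Ω ![I • u, I • v] = Ω ![u, v]) {q : QuadraticForm ℝ E} (hq : ∀ u, q u = Ω ![u, I • u])
    {N : Submodule ℂ E} (hN : ∀ v ∈ N, v ≠ 0 → Ω ![v, I • v] < 0)
    (hNmax : ∀ Q : Submodule ℂ E, (∀ v ∈ Q, v ≠ 0 → Ω ![v, I • v] < 0) → finrank ℂ Q ≤ finrank ℂ N) :
    sigNeg q = 2 * finrank ℂ N := by
  classical
  obtain ⟨b, d, hb₁, hb₂⟩ := exists_orthogonal_frame hΩI
  rw [sigNeg_eq_two_mul_card_neg hΩI b hb₁ hb₂ hq, card_neg_eq_finrank_of_maximal hΩI b hb₁ hb₂ hN hNmax]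

/-- **`dim_ℝ rad q = 2 n₀`**: the radical of the real quadratic form `q` has real dimension twice the number of null
diagonal entries of any `h`-orthogonal complex frame (by Mathlib's count `sigPos q + sigNeg q + dim_ℝ rad q = dim_ℝ E
= 2 · #ι` and the trichotomy `#{d > 0} + #{d < 0} + #{d = 0} = #ι`; that `#{d = 0}` is the complex dimension of the
null space `V₀` of `Ω` is the tree's `exists_nullSpace_finrank_eq_card`). [cite: BuskinIzadi2020TwistorLinesTori, §5 (arXiv v2 p.23 L26–30: "the null subspace V₀ = {u ∈ V_ℝ | h(u, v) = 0 for all v ∈ V_ℝ} = {u ∈ V_ℝ | Ω(u, v) = 0 for all v ∈ V_ℝ} of h in (V_ℝ, I), so that n₊ + n₋ + n₀ = 2n")] -/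
theorem finrank_radical_eq_two_mul_card_null [FiniteDimensional ℂ E] {Ω : E [⋀^Fin 2]→L[ℝ] ℝ}
    (hΩI : ∀ u v : E, Ω ![I • u, I • v] = Ω ![u, v]) (b : Module.Basis ι ℂ E) {d : ι → ℝ}
    (hb₁ : ∀ k l, Ω ![b k, I • b l] = if k = l then d k else 0) (hb₂ : ∀ k l, Ω ![b k, b l] = 0)
    {q : QuadraticForm ℝ E} (hq : ∀ u, q u = Ω ![u, I • u]) :
    finrank ℝ q.radical = 2 * Fintype.card {i // d i = 0} := by
  haveI : FiniteDimensional ℝ E := FiniteDimensional.complexToReal E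
  have hpos := sigPos_eq_two_mul_card_pos hΩI b hb₁ hb₂ hq
  have hneg := sigNeg_eq_two_mul_card_neg hΩI b hb₁ hb₂ hq
  have hsum := QuadraticForm.sigPos_add_sigNeg_add_radical (Q := q)
  have hE : finrank ℝ E = 2 * Fintype.card ι := by
    rw [← Module.finrank_mul_finrank ℝ ℂ E, Complex.finrank_real_complex, Module.finrank_eq_card_basis b]
  have htri : Fintype.card {i // 0 < d i} + Fintype.card {i // d i < 0} + Fintype.card {i // d i = 0} =
      Fintype.card ι := by
    classical
    rw [Fintype.card_subtype, Fintype.card_subtype, Fintype.card_subtype, Finset.card_filter, Finset.card_filter,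
      Finset.card_filter, ← Finset.sum_add_distrib, ← Finset.sum_add_distrib, Finset.card_univ.symm,
      Finset.card_eq_sum_ones]
    refine Finset.sum_congr rfl fun i _ ↦ ?_
    rcases lt_trichotomy (d i) 0 with h | h | h
    · simp [h, h.ne, not_lt.mpr h.le]
    · simp [h]
    · simp [h, h.ne', not_lt.mpr h.le]
  omega

end Frame

/-! ## §3 The criterion of Thm. 5.4 as `sigPos q = sigNeg q` -/

/-- **[BI20] Thm. 5.4's signature criterion, Sylvester form.** For an `I`-invariant real `2`-covector `Ω` on an
even-dimensional complex vector space `(V_ℝ, I) = E` and the real quadratic form `q(u) = h(u, u) = Ω(u, Iu)`: a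
complex-structure operator `J` anticommuting with `I` and leaving `Ω` invariant — the pointwise content of a twistor
line `S(I, J) ⊂ Compl_Ω` through `I` (Thm. 5.4, p.24 L64–74: "If `n₀` is even, there is precisely one connected
component of `Compl^±_Ω` that contains twistor lines. This component is `Sign⁻¹(n − n₀/2, n − n₀/2, n₀)` […]. If `n₀`
is odd, there are no connected components of `Compl^±_Ω` containing a twistor line."; proof, p.26 L26–28: "We first
note that `Compl_Ω` contains a twistor line `S = S(I, J)` if and only if `Ω` is both `I`- and `J`-invariant, that is,
`I, J ∈ Compl_Ω`.", L36–39: "[…] that is, `n₊ = n₋`. It also follows that `n₀` is even.", L40–42: "Conversely, if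
[…] we have the equality `n₊ = n₋`, we construct a complex structure operator `J : V_ℝ → V_ℝ` anticommuting with
`I` and leaving `Ω` invariant as follows.") — EXISTS if and only if `sigPos q = sigNeg q`, the printed `n₊ = n₋`
doubled. The tree's `exists_anticommuting_invariant_iff_finrank_pos_eq_finrank_neg` read through
`sigPos_eq_two_mul_card_pos` ∕ `sigNeg_eq_two_mul_card_neg`. [cite: BuskinIzadi2020TwistorLinesTori, Thm. 5.4 (arXiv v2 p.24 L54–74; proof p.26 L26–p.27 L7)] -/
theorem exists_anticommuting_invariant_iff_sigPos_eq_sigNeg [FiniteDimensional ℂ E] {Ω : E [⋀^Fin 2]→L[ℝ] ℝ}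
    (hΩI : ∀ u v : E, Ω ![I • u, I • v] = Ω ![u, v]) (hE : Even (finrank ℂ E)) {q : QuadraticForm ℝ E}
    (hq : ∀ u, q u = Ω ![u, I • u]) :
    (∃ J : E →L[ℝ] E, (∀ v, J (J v) = -v) ∧ (∀ v, J (I • v) = -(I • J v)) ∧ ∀ u v, Ω ![J u, J v] = Ω ![u, v]) ↔
      sigPos q = sigNeg q := by
  classical
  obtain ⟨b, d, hb₁, hb₂⟩ := exists_orthogonal_frame hΩI
  obtain ⟨P₀, hP₀, hP₀d⟩ := exists_pos_submodule_finrank_eq_card hΩI b hb₁ hb₂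
  have hP₀max : ∀ Q : Submodule ℂ E, (∀ v ∈ Q, v ≠ 0 → 0 < Ω ![v, I • v]) → finrank ℂ Q ≤ finrank ℂ P₀ :=
    fun Q hQ ↦ hP₀d ▸ finrank_le_card_pos hΩI b hb₁ hb₂ hQ
  -- the negative side through `−Ω`
  have hΩI' : ∀ u v : E, (-Ω) ![I • u, I • v] = (-Ω) ![u, v] := fun u v ↦ by
    simp only [ContinuousAlternatingMap.neg_apply, hΩI]
  have hb₁' : ∀ k l, (-Ω) ![b k, I • b l] = if k = l then -d k else 0 := fun k l ↦ by
    rw [ContinuousAlternatingMap.neg_apply, hb₁]; split_ifs <;> simp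
  have hb₂' : ∀ k l, (-Ω) ![b k, b l] = 0 := fun k l ↦ by rw [ContinuousAlternatingMap.neg_apply, hb₂, neg_zero]
  obtain ⟨N₀, hN₀', hN₀d⟩ := exists_pos_submodule_finrank_eq_card hΩI' b hb₁' hb₂'
  have hN₀ : ∀ v ∈ N₀, v ≠ 0 → Ω ![v, I • v] < 0 := fun v hv h0 ↦ by
    have h := hN₀' v hv h0
    rwa [ContinuousAlternatingMap.neg_apply, neg_pos] at h
  have hN₀max : ∀ Q : Submodule ℂ E, (∀ v ∈ Q, v ≠ 0 → Ω ![v, I • v] < 0) → finrank ℂ Q ≤ finrank ℂ N₀ :=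
    fun Q hQ ↦ hN₀d ▸ finrank_le_card_pos hΩI' b hb₁' hb₂' fun v hv h0 ↦ by
      rw [ContinuousAlternatingMap.neg_apply, neg_pos]; exact hQ v hv h0
  rw [exists_anticommuting_invariant_iff_finrank_pos_eq_finrank_neg hΩI hE hP₀ hP₀max hN₀ hN₀max,
    ← card_pos_eq_finrank_of_maximal hΩI b hb₁ hb₂ hP₀ hP₀max,
    ← card_neg_eq_finrank_of_maximal hΩI b hb₁ hb₂ hN₀ hN₀max, sigPos_eq_two_mul_card_pos hΩI b hb₁ hb₂ hq,
    sigNeg_eq_two_mul_card_neg hΩI b hb₁ hb₂ hq]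
  omega

/-- **… and then a full linear hyperkähler structure.** If `sigPos q = sigNeg q`, there are an inner product `g₀` and a
`J` with `(g₀, I, J, K = IJ)` linear hyperkähler and `Ω` `J`-invariant, `ad J Ω = 0` (the tree's
`exists_isLinearHyperkaehler_invariant_of_finrank_pos_eq_finrank_neg`). [cite: BuskinIzadi2020TwistorLinesTori, §5 proof of Thm. 5.4 (arXiv v2 p.26 L40–p.27 L7)] -/
theorem exists_isLinearHyperkaehler_invariant_of_sigPos_eq_sigNeg [FiniteDimensional ℂ E] {Ω : E [⋀^Fin 2]→L[ℝ] ℝ}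
    (hΩI : ∀ u v : E, Ω ![I • u, I • v] = Ω ![u, v]) (hE : Even (finrank ℂ E)) {q : QuadraticForm ℝ E}
    (hq : ∀ u, q u = Ω ![u, I • u]) (hsig : sigPos q = sigNeg q) :
    ∃ (g₀ : E →L[ℝ] E →L[ℝ] ℝ) (J : E →L[ℝ] E), IsLinearHyperkaehler g₀ J ∧
      (∀ u v : E, Ω ![J u, J v] = Ω ![u, v]) ∧ adAlt J Ω = 0 := by
  classical
  obtain ⟨b, d, hb₁, hb₂⟩ := exists_orthogonal_frame hΩI
  have hpos := sigPos_eq_two_mul_card_pos hΩI b hb₁ hb₂ hq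
  have hneg := sigNeg_eq_two_mul_card_neg hΩI b hb₁ hb₂ hq
  have hcard : Fintype.card {i // 0 < d i} = Fintype.card {i // d i < 0} := by omega
  have hrad := finrank_radical_eq_two_mul_card_null hΩI b hb₁ hb₂ hq
  haveI : FiniteDimensional ℝ E := FiniteDimensional.complexToReal E
  have hsum := QuadraticForm.sigPos_add_sigNeg_add_radical (Q := q)
  have hEr : finrank ℝ E = 2 * finrank ℂ E := by
    rw [← Module.finrank_mul_finrank ℝ ℂ E, Complex.finrank_real_complex]
  obtain ⟨m, hm⟩ := hE
  have heven : Even (Fintype.card {i // d i = 0}) := ⟨m - Fintype.card {i // 0 < d i}, by omega⟩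
  exact exists_isLinearHyperkaehler_invariant_of_card_pos_eq_card_neg hΩI b hb₁ hb₂ hcard heven

end Literature.Geometry.Hyperkaehler.TwistorLineSylvester

end PartB

end
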